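import Mathlib
import Literature.AlgebraicGeometry.Resolution.BlowupChartRsop
import Literature.AlgebraicGeometry.Resolution.AffineBlowupAlgebra
import HarnessLib

/-!
# Programme V3U, chart a: the Rees chart `D₊(x_a t)` of `Bl_{(x_a, x_b²)} 𝔸ⁿ` is the even part of the root chart

(crux stmt-ResolutionOfSingularities-15640 `WildQuotients.WildQuotientResolution`, line `Sketch`,
sector `|G| = p`; programme V3U of `L/w45c/CHAIN.md` v5 §4 row stub-2, candidate **D3 = (C0) ring
half** of `W45cPlanSignaturesV5.lean` VERBATIM up to unfolding the abbreviation `chartAGens`;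
[OURS · L1 W4.5c] — NOT a statement of any manuscript.)

The chart ring `k[x][(x_a, x_b²)/x_a] = k[x_a, x_b, r, …]/(x_b² − x_a r)` of the blow-up of `𝔸ⁿ`
along `(x_a, x_b²)` is, as a ring, the EVEN subalgebra `k[ρ², ρβ, β², (x_i)_{i ≠ a,b}]` of the root
chart `k[ρ, β, …]` (we re-use the variables: `ρ = X a`, `β = X b`): the isomorphism carries the
structure map `chartBase` to the substitution `x_a ↦ ρ²`, `x_b ↦ ρβ`, `x_i ↦ x_i` and the chart
generator `(x_b² t)/(x_a t)` to `β²` (`chartA_ringEquiv_adjoin`). Proof: the substitution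
`ψ₀ : k[x] → k[ρ, β, …]` is injective (`rootSubst_injective`: it is `x_b ↦ x_a x_b` after
`x_a ↦ x_a²`, a `Polynomial.expand 2` in the variable `a`); its extension `h₀` to `k[x][1/x_a]`
(`x_a ↦ ρ²` is a unit in `k[ρ,β,…][1/ρ]`) is injective and maps the affine blowup algebra
`k[x][(x_a,x_b²)/x_a]` (`reesChartEquiv`) onto (the image of) `k[ρ², ρβ, β², …]`
(`x_b²/x_a ↦ ρ²β²/ρ² = β²`). The EQUIVARIANT half (the lifted `⟨σ⟩`-action is the translation
`β ↦ β + ρ` restricted) is V3U-F (lead-1).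
-/

-- single-problem summit: the doubled namespace component `ResolutionOfSingularities` is forced
set_option linter.dupNamespace false

noncomputable section

open MvPolynomial IsLocalization Literature.AlgebraicGeometry.Resolution

namespace Summit.ResolutionOfSingularities.ResolutionOfSingularities.Theorems.WildQuotientResolution.ToricExit

/-- **The root substitution is injective**: `x_a ↦ x_a²`, `x_b ↦ x_a x_b`, `x_i ↦ x_i` (`a ≠ b`)
is an injective `k`-algebra endomorphism of `k[x₁,…,xₙ]` — it factors as `x_a ↦ x_a²`
(`Polynomial.expand 2` in the variable `a`, injective) followed by `x_b ↦ x_a x_b` (injective: after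
inverting `x_a` it is retracted by `x_b ↦ x_b/x_a`). [folklore] -/
theorem rootSubst_injective (k : Type) [Field k] (n : ℕ) (a b : Fin n) (hab : a ≠ b) :
    Function.Injective (fun f : MvPolynomial (Fin n) k =>
      MvPolynomial.aeval (fun i => (if i = a then X a ^ 2 else if i = b then X a * X b else X i :
        MvPolynomial (Fin n) k)) f) := by
  classical
  let τ₁ : MvPolynomial (Fin n) k →ₐ[k] MvPolynomial (Fin n) k :=
    aeval fun i => if i = a then X a ^ 2 else X i
  let τ₂ : MvPolynomial (Fin n) k →ₐ[k] MvPolynomial (Fin n) k :=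
    aeval fun i => if i = b then X a * X b else X i
  have hba : b ≠ a := fun h => hab h.symm
  have hcomp : ∀ f : MvPolynomial (Fin n) k,
      MvPolynomial.aeval (fun i => (if i = a then X a ^ 2 else if i = b then X a * X b else X i :
        MvPolynomial (Fin n) k)) f = τ₂ (τ₁ f) := by
    intro f
    have h : (MvPolynomial.aeval
        (fun i => (if i = a then X a ^ 2 else if i = b then X a * X b else X i :
          MvPolynomial (Fin n) k)) :
          MvPolynomial (Fin n) k →ₐ[k] MvPolynomial (Fin n) k) = τ₂.comp τ₁ := by
      refine MvPolynomial.algHom_ext fun i => ?_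
      by_cases hi : i = a
      · subst hi
        simp [τ₁, τ₂, hab]
      · by_cases hib : i = b
        · subst hib
          simp [τ₁, τ₂, hi]
        · simp [τ₁, τ₂, hi, hib]
    exact DFunLike.congr_fun h f
  -- `τ₂` is injective: `x_b ↦ x_b / x_a` retracts it in `k[x][1/x_a]`
  have h2 : Function.Injective τ₂ := by
    let L := Localization.Away (X a : MvPolynomial (Fin n) k)
    let θ : MvPolynomial (Fin n) k →ₐ[k] L :=
      aeval fun i => if i = b then
        algebraMap (MvPolynomial (Fin n) k) L (X b) * Away.invSelf (X a : MvPolynomial (Fin n) k)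
        else algebraMap (MvPolynomial (Fin n) k) L (X i)
    have hθ : ∀ f, θ (τ₂ f) = algebraMap (MvPolynomial (Fin n) k) L f := by
      intro f
      have h : θ.comp τ₂ = IsScalarTower.toAlgHom k (MvPolynomial (Fin n) k) L := by
        refine MvPolynomial.algHom_ext fun i => ?_
        by_cases hib : i = b
        · subst hib
          simp only [τ₂, θ, AlgHom.comp_apply, aeval_X, if_true, map_mul, hab, if_false,
            IsScalarTower.toAlgHom_apply]
          rw [mul_comm, mul_assoc, mul_comm (Away.invSelf _), Away.mul_invSelf, mul_one]
        · simp [τ₂, θ, hib]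
      exact DFunLike.congr_fun h f
    intro f g hfg
    have h := congrArg θ hfg
    rw [hθ, hθ] at h
    exact IsLocalization.injective L (M := Submonoid.powers (X a : MvPolynomial (Fin n) k))
      (Submonoid.powers_le.2 (mem_nonZeroDivisors_of_ne_zero (X_ne_zero a))) h
  -- `τ₁` is injective: it is `expand 2` in the variable `a`
  have h1 : Function.Injective τ₁ := by
    let Ξ : MvPolynomial (Fin n) k ≃ₐ[k] Polynomial (MvPolynomial {i : Fin n // i ≠ a} k) :=
      (MvPolynomial.renameEquiv k (Equiv.optionSubtypeNe a).symm).trans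
        (MvPolynomial.optionEquivLeft k {i : Fin n // i ≠ a})
    have hΞa : Ξ (X a) = Polynomial.X := by
      simp only [Ξ, AlgEquiv.trans_apply, MvPolynomial.renameEquiv_apply, MvPolynomial.rename_X,
        Equiv.optionSubtypeNe_symm_self, MvPolynomial.optionEquivLeft_X_none]
    have hΞi : ∀ (i : Fin n) (hi : i ≠ a), Ξ (X i) = Polynomial.C (X ⟨i, hi⟩) := by
      intro i hi
      simp only [Ξ, AlgEquiv.trans_apply, MvPolynomial.renameEquiv_apply, MvPolynomial.rename_X,
        Equiv.optionSubtypeNe_symm_of_ne hi, MvPolynomial.optionEquivLeft_X_some]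
    let E2 : Polynomial (MvPolynomial {i : Fin n // i ≠ a} k) →ₐ[k]
        Polynomial (MvPolynomial {i : Fin n // i ≠ a} k) :=
      (Polynomial.expand (MvPolynomial {i : Fin n // i ≠ a} k) 2).restrictScalars k
    have hΞa' : (Ξ : MvPolynomial (Fin n) k →ₐ[k] Polynomial (MvPolynomial {i : Fin n // i ≠ a} k))
        (X a) = Polynomial.X := hΞa
    have hΞi' : ∀ (i : Fin n) (hi : i ≠ a),
        (Ξ : MvPolynomial (Fin n) k →ₐ[k] Polynomial (MvPolynomial {i : Fin n // i ≠ a} k)) (X i) =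
          Polynomial.C (X ⟨i, hi⟩) := hΞi
    have key : ∀ f, Ξ (τ₁ f) = E2 (Ξ f) := by
      intro f
      have h : (Ξ : MvPolynomial (Fin n) k →ₐ[k] _).comp τ₁ =
          E2.comp (Ξ : MvPolynomial (Fin n) k →ₐ[k] _) := by
        refine MvPolynomial.algHom_ext fun i => ?_
        by_cases hi : i = a
        · subst hi
          simp only [AlgHom.comp_apply, τ₁, E2, aeval_X, if_true, map_pow, hΞa',
            AlgHom.coe_restrictScalars', Polynomial.expand_X]
        · simp only [AlgHom.comp_apply, τ₁, E2, aeval_X, hi, if_false, hΞi' i hi,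
            AlgHom.coe_restrictScalars', Polynomial.expand_C]
      exact DFunLike.congr_fun h f
    intro f g hfg
    apply Ξ.injective
    apply Polynomial.expand_injective (by norm_num : 0 < 2)
    have h := congrArg Ξ hfg
    rw [key, key] at h
    exact h
  intro f g hfg
  have h : τ₂ (τ₁ f) = τ₂ (τ₁ g) := by rw [← hcomp, ← hcomp]; exact hfg
  exact h1 (h2 h)

/-- **D3 = (C0) ring half**: the Rees chart ring `k[x][(x_a, x_b²)/x_a] = k[x_a, x_b, r, …]/(x_b² − x_a r)`
of `Bl_{(x_a,x_b²)} 𝔸ⁿ` at the generator `x_a` is the even subalgebra `k[ρ², ρβ, β², …] ⊂ k[ρ, β, …]`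
of the root chart: a ring isomorphism carrying `chartBase` to the substitution `x_a ↦ ρ²`, `x_b ↦ ρβ`,
`x_i ↦ x_i` and the chart generator `(x_b² t)/(x_a t) ↦ β²` (V5 `chartA_ringEquiv_adjoin` with
`chartAGens` unfolded). [OURS · L1 W4.5c] [folklore] -/
theorem chartA_ringEquiv_adjoin (k : Type) [Field k] (n : ℕ) (a b : Fin n) (hab : a ≠ b) :
    ∃ e : chartRing (![X a, X b ^ 2] : Fin 2 → MvPolynomial (Fin n) k) 0 ≃+*
        ↥(Algebra.adjoin k
          (({X a ^ 2, X a * X b, X b ^ 2} ∪ ((fun i => X i) '' {i | i ≠ a ∧ i ≠ b})) :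
            Set (MvPolynomial (Fin n) k))),
      (∀ f : MvPolynomial (Fin n) k,
        ((e (chartBase (![X a, X b ^ 2] : Fin 2 → MvPolynomial (Fin n) k) 0 f) :
            ↥(Algebra.adjoin k
              (({X a ^ 2, X a * X b, X b ^ 2} ∪ ((fun i => X i) '' {i | i ≠ a ∧ i ≠ b})) :
                Set (MvPolynomial (Fin n) k)))) : MvPolynomial (Fin n) k) =
          MvPolynomial.aeval (fun i => if i = a then X a ^ 2 else if i = b then X a * X b else X i) f) ∧
      ((e (chartGen (![X a, X b ^ 2] : Fin 2 → MvPolynomial (Fin n) k) 0 1) :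
          ↥(Algebra.adjoin k
            (({X a ^ 2, X a * X b, X b ^ 2} ∪ ((fun i => X i) '' {i | i ≠ a ∧ i ≠ b})) :
              Set (MvPolynomial (Fin n) k)))) : MvPolynomial (Fin n) k) = X b ^ 2 := by
  classical
  set c : Fin 2 → MvPolynomial (Fin n) k := ![X a, X b ^ 2] with hc
  have hc0 : c 0 = X a := rfl
  have hc1 : c 1 = X b ^ 2 := rfl
  have hba : b ≠ a := fun h => hab h.symm
  set S : Set (MvPolynomial (Fin n) k) :=
    {X a ^ 2, X a * X b, X b ^ 2} ∪ ((fun i => X i) '' {i | i ≠ a ∧ i ≠ b}) with hS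
  set E : Subalgebra k (MvPolynomial (Fin n) k) := Algebra.adjoin k S with hE
  -- the root substitution
  let ψ₀ : MvPolynomial (Fin n) k →ₐ[k] MvPolynomial (Fin n) k :=
    aeval fun i => if i = a then X a ^ 2 else if i = b then X a * X b else X i
  have hψa : ψ₀ (X a) = X a ^ 2 := by simp [ψ₀]
  have hψb : ψ₀ (X b) = X a * X b := by simp [ψ₀, hba]
  have hψi : ∀ i, i ≠ a → i ≠ b → ψ₀ (X i) = X i := fun i hi hi' => by simp [ψ₀, hi, hi']
  have hψinj : Function.Injective ψ₀ := rootSubst_injective k n a b hab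
  -- generators of `E`
  have hEa : (X a ^ 2 : MvPolynomial (Fin n) k) ∈ E :=
    Algebra.subset_adjoin (Or.inl (Set.mem_insert _ _))
  have hEb : (X a * X b : MvPolynomial (Fin n) k) ∈ E :=
    Algebra.subset_adjoin (Or.inl (Set.mem_insert_of_mem _ (Set.mem_insert _ _)))
  have hEbb : (X b ^ 2 : MvPolynomial (Fin n) k) ∈ E :=
    Algebra.subset_adjoin (Or.inl (Set.mem_insert_of_mem _ (Set.mem_insert_of_mem _ rfl)))
  have hEi : ∀ i, i ≠ a → i ≠ b → (X i : MvPolynomial (Fin n) k) ∈ E := fun i hi hi' =>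
    Algebra.subset_adjoin (Or.inr ⟨i, ⟨hi, hi'⟩, rfl⟩)
  -- `ψ₀` lands in `E`
  have hψE : ∀ f, ψ₀ f ∈ E := by
    intro f
    induction f using MvPolynomial.induction_on with
    | C t =>
      rw [← MvPolynomial.algebraMap_eq, AlgHom.commutes]
      exact Subalgebra.algebraMap_mem _ _
    | add p q hp hq =>
      rw [map_add]
      exact Subalgebra.add_mem _ hp hq
    | mul_X p i hp =>
      rw [map_mul]
      refine Subalgebra.mul_mem _ hp ?_
      by_cases hi : i = a
      · subst hi; rw [hψa]; exact hEa
      · by_cases hi' : i = b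
        · subst hi'; rw [hψb]; exact hEb
        · rw [hψi i hi hi']; exact hEi i hi hi'
  -- the localisation `k[x][1/x_a]`, used for both the chart and the root chart
  set L := Localization.Away (c 0)
  set ι := algebraMap (MvPolynomial (Fin n) k) L with hιdef
  let ιₐ : MvPolynomial (Fin n) k →ₐ[k] L := IsScalarTower.toAlgHom k (MvPolynomial (Fin n) k) L
  have hιₐ : ∀ r, ιₐ r = ι r := fun r => rfl
  have hιinj : Function.Injective ι :=
    IsLocalization.injective L (M := Submonoid.powers (c 0))
      (Submonoid.powers_le.2 (mem_nonZeroDivisors_of_ne_zero (by rw [hc0]; exact X_ne_zero a)))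
  have hιₐinj : Function.Injective ιₐ := hιinj
  have hu : ι (c 0) * Away.invSelf (c 0) = 1 := Away.mul_invSelf (c 0)
  -- the extension `h₀` of `ψ₀` to `k[x][1/x_a]`
  have hψc0 : ψ₀ (c 0) = c 0 ^ 2 := by rw [hc0, hψa]
  let g : MvPolynomial (Fin n) k →+* L := ι.comp ψ₀.toRingHom
  have hg : IsUnit (g (c 0)) := by
    change IsUnit (ι (ψ₀ (c 0)))
    rw [hψc0, map_pow]
    exact (IsLocalization.Away.algebraMap_isUnit (S := L) (c 0)).pow 2
  let h₀ : L →+* L := IsLocalization.Away.lift (c 0) hg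
  have hh₀ι : ∀ r, h₀ (ι r) = ι (ψ₀ r) := fun r => IsLocalization.Away.lift_eq (c 0) hg r
  have hh₀inv : ι (c 0 ^ 2) * h₀ (Away.invSelf (c 0)) = 1 := by
    have h1 : h₀ (ι (c 0) * Away.invSelf (c 0)) = 1 := by rw [hu, map_one]
    rwa [map_mul, hh₀ι, hψc0] at h1
  have hψc1 : ψ₀ (c 1) = X b ^ 2 * c 0 ^ 2 := by
    rw [hc1, map_pow, hψb, hc0]; ring
  -- `h₀` is injective
  have hh₀inj : Function.Injective h₀ := by
    rw [injective_iff_map_eq_zero]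
    intro z hz
    obtain ⟨⟨r, s⟩, hzr⟩ := IsLocalization.surj (Submonoid.powers (c 0)) z
    change z * ι s = ι r at hzr
    have hr : ψ₀ r = 0 := by
      apply hιinj
      rw [map_zero, ← hh₀ι, ← hzr, map_mul, hz, zero_mul]
    have hr0 : r = 0 := hψinj (by rw [hr, map_zero])
    rw [hr0, map_zero] at hzr
    exact (IsLocalization.map_units L s).mul_left_eq_zero.mp hzr
  -- the affine blowup algebra and its image
  set Bl := blowupAlgebra (Ideal.span (Set.range c)) (c 0) with hBl
  have hI : ∀ x ∈ Ideal.span (Set.range c), ∃ u v : MvPolynomial (Fin n) k,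
      u * X a + v * X b ^ 2 = x := by
    intro x hx
    obtain ⟨d, hd⟩ := Ideal.mem_span_range_iff_exists_fun.mp hx
    refine ⟨d 0, d 1, ?_⟩
    rw [← hd, Fin.sum_univ_two, hc0, hc1]
  -- (i) `h₀(Bl) ⊆ ι(E)`
  have hsub : ∀ z, z ∈ Bl → h₀ z ∈ E.map ιₐ := by
    intro z hz
    refine Algebra.adjoin_induction (fun y hy => ?_) (fun r => ?_) (fun _ _ _ _ hx hy => ?_)
      (fun _ _ _ _ hx hy => ?_) hz
    · obtain ⟨x, hx, rfl⟩ := hy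
      obtain ⟨u, v, rfl⟩ := hI x hx
      have hw : ψ₀ u + ψ₀ v * X b ^ 2 ∈ E :=
        Subalgebra.add_mem _ (hψE u) (Subalgebra.mul_mem _ (hψE v) hEbb)
      refine Subalgebra.mem_map.mpr ⟨_, hw, ?_⟩
      have hx : ψ₀ (u * X a + v * X b ^ 2) = (ψ₀ u + ψ₀ v * X b ^ 2) * c 0 ^ 2 := by
        rw [map_add, map_mul, map_mul, map_pow, hψa, hψb, hc0]; ring
      rw [hιₐ, map_mul, hh₀ι, hx, map_mul, mul_assoc, hh₀inv, mul_one]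
    · refine Subalgebra.mem_map.mpr ⟨ψ₀ r, hψE r, ?_⟩
      rw [hιₐ, ← hh₀ι]
    · rw [map_add]; exact Subalgebra.add_mem _ hx hy
    · rw [map_mul]; exact Subalgebra.mul_mem _ hx hy
  -- (ii) `ι(E) ⊆ h₀(Bl)`
  have hsup : ∀ q, q ∈ E → ∃ z, z ∈ Bl ∧ h₀ z = ι q := by
    intro q hq
    refine Algebra.adjoin_induction (fun y hy => ?_) (fun t => ?_) (fun _ _ _ _ hx hy => ?_)
      (fun _ _ _ _ hx hy => ?_) hq
    · rcases hy with hy | ⟨i, ⟨hi, hi'⟩, rfl⟩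
      · rcases hy with rfl | rfl | hy
        · exact ⟨ι (c 0), Subalgebra.algebraMap_mem _ _, by
            rw [hh₀ι, hψc0]; exact congrArg ι (by rw [hc0])⟩
        · exact ⟨ι (X b), Subalgebra.algebraMap_mem _ _, by rw [hh₀ι, hψb]⟩
        · rw [Set.mem_singleton_iff] at hy
          subst hy
          refine ⟨ι (c 1) * Away.invSelf (c 0),
            div_mem_blowupAlgebra _ _ (Ideal.mem_span_range_self (f := c) (x := 1)), ?_⟩
          rw [map_mul, hh₀ι, hψc1, map_mul, mul_assoc, hh₀inv, mul_one]
      · exact ⟨ι (X i), Subalgebra.algebraMap_mem _ _, by rw [hh₀ι, hψi i hi hi']⟩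
    · refine ⟨ι (C t), Subalgebra.algebraMap_mem _ _, ?_⟩
      rw [hh₀ι, ← MvPolynomial.algebraMap_eq, AlgHom.commutes]
    · obtain ⟨z₁, hz₁, h₁⟩ := hx
      obtain ⟨z₂, hz₂, h₂⟩ := hy
      exact ⟨z₁ + z₂, Subalgebra.add_mem _ hz₁ hz₂, by rw [map_add, h₁, h₂, map_add]⟩
    · obtain ⟨z₁, hz₁, h₁⟩ := hx
      obtain ⟨z₂, hz₂, h₂⟩ := hy
      exact ⟨z₁ * z₂, Subalgebra.mul_mem _ hz₁ hz₂, by rw [map_mul, h₁, h₂, map_mul]⟩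
  -- the isomorphism `Bl ≃ E.map ιₐ ≃ E`
  let Φ : Bl →+* ↥(E.map ιₐ) :=
    (h₀.comp Bl.toSubring.subtype).codRestrict (E.map ιₐ).toSubring fun z => hsub z z.2
  have hΦ : Function.Bijective Φ := by
    refine ⟨fun z₁ z₂ h => Subtype.ext (hh₀inj (congrArg Subtype.val h)), fun y => ?_⟩
    obtain ⟨q, hq, hqy⟩ := Subalgebra.mem_map.mp y.2
    obtain ⟨z, hz, hzq⟩ := hsup q hq
    exact ⟨⟨z, hz⟩, Subtype.ext (by rw [← hqy]; exact hzq)⟩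
  let e₁ : Bl ≃+* ↥(E.map ιₐ) := RingEquiv.ofBijective Φ hΦ
  let e₂ : ↥(E.map ιₐ) ≃+* ↥E := (Subalgebra.equivMapOfInjective E ιₐ hιₐinj).symm.toRingEquiv
  have he₂ : ∀ (w : MvPolynomial (Fin n) k) (hw : w ∈ E) (hw' : ι w ∈ E.map ιₐ),
      (e₂ ⟨ι w, hw'⟩ : MvPolynomial (Fin n) k) = w := by
    intro w hw hw'
    have h : (Subalgebra.equivMapOfInjective E ιₐ hιₐinj) ⟨w, hw⟩ = ⟨ι w, hw'⟩ :=
      Subtype.ext (Subalgebra.coe_equivMapOfInjective_apply E ιₐ hιₐinj ⟨w, hw⟩)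
    have h' : e₂ ⟨ι w, hw'⟩ = ⟨w, hw⟩ := by
      change (Subalgebra.equivMapOfInjective E ιₐ hιₐinj).symm ⟨ι w, hw'⟩ = ⟨w, hw⟩
      rw [AlgEquiv.symm_apply_eq, h]
    rw [h']
  refine ⟨(reesChartEquiv (c 0) (Ideal.mem_span_range_self (f := c) (x := 0))).trans (e₁.trans e₂),
    fun f => ?_, ?_⟩
  · -- the structure map goes to the substitution
    have h1 : reesChartEquiv (c 0) (Ideal.mem_span_range_self (f := c) (x := 0)) (chartBase c 0 f) =
        algebraMap (MvPolynomial (Fin n) k) Bl f := reesChartEquiv_reesChartBase _ _ f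
    have h2 : e₁ (algebraMap (MvPolynomial (Fin n) k) Bl f) =
        ⟨ι (ψ₀ f), Subalgebra.mem_map.mpr ⟨ψ₀ f, hψE f, rfl⟩⟩ := by
      apply Subtype.ext
      change h₀ (ι f) = ι (ψ₀ f)
      exact hh₀ι f
    rw [RingEquiv.trans_apply, RingEquiv.trans_apply, h1, h2, he₂ (ψ₀ f) (hψE f)]
  · -- the chart generator goes to `β²`
    have h1 : ((reesChartEquiv (c 0) (Ideal.mem_span_range_self (f := c) (x := 0)) (chartGen c 0 1) : Bl) : L) =
        ι (c 1) * Away.invSelf (c 0) := by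
      rw [coe_reesChartEquiv]
      change reesChart (c 0) _ (HomogeneousLocalization.Away.mk _ _ 1 (reesT (c 1) _) _) = _
      rw [reesChart_mk (c 0) _ (reesT_mem_one_smul c 1) (coe_reesT (c 1) _), pow_one]
    have hmem : ι (X b ^ 2) ∈ E.map ιₐ := Subalgebra.mem_map.mpr ⟨X b ^ 2, hEbb, rfl⟩
    have h2 : e₁ (reesChartEquiv (c 0) (Ideal.mem_span_range_self (f := c) (x := 0)) (chartGen c 0 1)) =
        ⟨ι (X b ^ 2), hmem⟩ := by
      apply Subtype.ext
      change h₀ ((reesChartEquiv (c 0) _ (chartGen c 0 1) : Bl) : L) = ι (X b ^ 2)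
      rw [h1, map_mul, hh₀ι, hψc1, map_mul, mul_assoc, hh₀inv, mul_one]
    rw [RingEquiv.trans_apply, RingEquiv.trans_apply, h2, he₂ (X b ^ 2) hEbb hmem]

end Summit.ResolutionOfSingularities.ResolutionOfSingularities.Theorems.WildQuotientResolution.ToricExit

end
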